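import Summits.BirchSwinnertonDyer.Rank1Residual.P2.CongruentNumberPairsAtTwoGenusPointData
import Summits.BirchSwinnertonDyer.Rank1Residual.P2.CongruentNumberPairsAtTwoDoorAAtlasThree
import Summits.BirchSwinnertonDyer.Rank1Residual.P2.CongruentNumberCor515SelmerEight
import Literature.NumberTheory.EllipticCurves.CongruentNumberOddMonskySelmerExact
import Literature.NumberTheory.EllipticCurves.CongruentNumberEvenMonskySelmerExact
import Literature.NumberTheory.QuadraticFields.RedeiReichardtFourRank
import HarnessLib

/-!
# Cell `bsd-print-cf2` (leaf CornerF @ `p = 2`, row B14), prover p2 — the `2`-DESCENT-MATRIX ROAD, file 1/2: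
# the rank-one genus DOORS on `B14 ∩ {j = 1728}` RE-KEYED TO KERNEL `2`-DESCENT
# (Monsky's `#Sel₂(E_D) = 2^{2+s(D)}` and Rédei–Reichardt are TREE THEOREMS; Monsky 1990 Cor 5.15 is
# replaced by the kernel Selmer count + Gross–Zagier–Kolyvagin) — displayed set `{TYZ, GZK}` and nothing else

HONEST FRAMING (cell `bsd-print-cf2`, HOME `run/shared/lean/pub/bsd-print-cf2/`; D-0131 (2) PRINT TIER;
PARTITION currency, D-0054 (2)). The leaf is `CornerF W 2 = HasCM ∧ analyticRank = 1` at `p = 2` (row B14 /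
O12 of `pub/pub-bsdres/PARTITION-SCOREBOARD.md`; `0` census cells, OPEN AS A CLASS). This file is about ONE
companion family inside it — the congruent-number curves `E_n : y² = x³ − n²x` (CM by `ℤ[i]`, `2` ramified)
of analytic rank one — and it asserts NO arithmetic fact: every theorem is a kernel theorem MODULO the named
journal facts in its binders, which after this file are EXACTLY
* `hTYZ : tyz_genusPointData` — Tian–Yuan–Zhang, Asian J. Math. 21 (2017) §3 (Prop. 3.4, Thm. 3.5,
  Lemmas 3.18/3.21), displayed sentence by sentence (`TianYuanZhang2017/GenusPointDescentDisplays.lean`), or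
  `h12 : thm12_parity_of_scriptL'` — ibid. Thm. 1.2 AS PRINTED (`GenusPeriodsParity.lean`, ERRATUM F-Σ2 form);
* `hGZK : rank_eq_analyticRank_of_analyticRank_le_one` — Gross–Zagier–Kolyvagin (`LeadingTerm.lean`).
"Beyond-print theorem": NO — the `2`-part of BSD for these families is asserted in print (Tian, Proc. ICM
2022, Thm. 8 / p. 1993, for the Tian–Yuan–Zhang/Smith families) and was already LITERAL-by-name in the tree;
what changes is the DISPLAYED SET. The doors landed by the sub-lane «bsd-p2» (2026-08-21…24) displayed, besides
`hTYZ`/`h12` and `hGZK`, up to three further named facts per door: Monsky's `2`-descent matrix theorem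
`hM : HeathBrown1994.monsky_card_selmerGroup_two_odd` / `hMe : …_even` (appendix to Heath-Brown 1994 —
flag `HB94-even-sketch` on the even side), the Rédei–Reichardt four-rank theorem
`hR : redeiReichardt_fourTwoCard_classGroup`, and Monsky 1990 Cor. 5.15 with Remark (2)
`h515 : Monsky1990.cor515_rank_eq_one_and_card_selmerGroup_two` (flags A301). Since then the tree PROVED
`hM`/`hMe` (`HeathBrown1994.monsky_card_selmerGroup_two_odd_holds` / `…_even_holds`, cell `bsd-monsky`
prover-B g15, p500655…p510805), `hR` (`RedeiReichardt.redeiReichardt_fourTwoCard_classGroup_holds`) and the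
Selmer clause of `h515` (`P2.card_selmerGroup_two_eq_eight_of_isCor515Family`, prover-A g11, p528474); the
rank clause of `h515` is supplied by `hTYZ`/`h12` (`ord_{s=1} L(E_n, s) = 1`) and `hGZK` (rank `1`). This
file performs the substitution for EVERY such door:

* §1 DOOR A / D-CN-6 (general `n = p₁⋯p_k ≡ 5, 7 (mod 8)`, Monsky kernel count `2`, a genus sum odd):
  `rankOne_sha_bsdp_two_congruentNumberCurve_of_genusPointData_descent` (ρ-free, `{hTYZ, hGZK}`),
  `…_of_genus_descent` (Thm 1.2 with `ρ(n) = 0`, `{h12, hGZK}`); the class-`6` door B6 (`n = 2p₁⋯p_k`,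
  even Monsky kernel count `2`, `Σ₂′` odd): `…_of_genusPointData_six_descent` (`{hTYZ, hGZK}`);
* §2 the `ω(n) = 3` atlas in configuration currency (`doorACfg`, `151 507` square-free `n < 3·10⁶` by the
  typer's desk count — EVIDENCE): `…_of_doorACfg_descent`, the upper-bits one-liner
  `bsdp_two_congruentNumberCurve_three_primes_of_doorACfg_descent`, class `7` from `s(n) = 1` ALONE
  (`…_three_primes_seven_descent`, `forall_…`), class `5` off the exceptional configuration
  (`…_three_primes_five_descent`), the sample family `p₁q₃r₅` (`forall_…_one_three_five_descent`) — all
  `{hTYZ, hGZK}`;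
* (file 2/2, `CongruentNumberGenusFamiliesKernelDescent.lean`) the uniform prime / two-prime families with
  NO per-member input: every prime `q ≡ 7 (mod 8)`, every `p₃·q₅`, every `p₃·q₇`.
Nothing here moves a census number (`0` cells in B14); nothing is booked by this file; no mark moved. What it
gives the cell's referee: on these sub-families of the leaf the by-name closure of `BSD(E, 2)` rests on ONE
displayed paper (TYZ 2017, refereed) plus GZK, with the `2`-descent side — `#Sel₂`, `Ш[2]`, `ρ`, genus
parities via Rédei matrices — decided in the kernel. Unit `bsd-print-cf2-p2` g0; NEW file.

References: [TianYuanZhang2017] Thm 1.2, §3 (Prop 3.4, Thm 3.5); [HeathBrown1994SelmerCongruentII] Appendix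
(Monsky) typescript pp. 39–41; [Monsky1990MockHeegner] Cor 5.15, Remark (2); [FaulknerJames2007] Thm 1.2 (2);
[Miller2011LMS] Def 1.1; [Tian2023CongruentICM] Thm 8, p. 1993.
-/

noncomputable section

open scoped Classical

open Matrix Finset WeierstrassCurve NumberField Literature.NumberTheory.EllipticCurves
  Literature.NumberTheory.EllipticCurves.Rank1Residual
  Literature.NumberTheory.EllipticCurves.Rank1Residual.Typed
  Literature.NumberTheory.EllipticCurves.Monsky1990
  Literature.NumberTheory.EllipticCurves.HeathBrown1994
  Literature.NumberTheory.EllipticCurves.HeathBrown1994.Families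
  Literature.NumberTheory.EllipticCurves.TianYuanZhang2017
  Literature.NumberTheory.EllipticCurves.Tian2014
  Literature.NumberTheory.EllipticCurves.FaulknerJames2007
  Literature.NumberTheory.QuadraticFields.RedeiReichardt

set_option autoImplicit false

namespace Summit.BirchSwinnertonDyer.Rank1Residual.P2

/-! ## §1 The general doors on kernel `2`-descent -/

section General

variable {k : ℕ} (p : Fin k → ℕ)

/-- **DOOR A ON KERNEL DESCENT (classes `5`, `7`; ρ-free).** For `n = p₁⋯p_k` (distinct odd primes),
`n ≡ 5, 7 (mod 8)`, Monsky kernel count `2` by the table route (`s(n) = 1`), and `Σ₁(n)` odd or `Σ₂′(n)` odd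
over `GenusField`: `ord_{s=1} L(E_n, s) = 1`, rank `1`, `Ш(E_n)[2^∞] = 0` and `BSD(E_n, 2)` — modulo `hTYZ`
and `hGZK` ONLY (Monsky's matrix theorem is the tree's `monsky_card_selmerGroup_two_odd_holds`).
[cite: TianYuanZhang2017, Thm. 1.2, Thm. 3.5 and §1 (1.1)]
[cite: HeathBrown1994SelmerCongruentII, Appendix (Monsky), typescript p. 39 L10–L33]
[cite: Miller2011LMS, Def. 1.1 (arXiv:1010.2431 p. 3)] -/
theorem rankOne_sha_bsdp_two_congruentNumberCurve_of_genusPointData_descent (hTYZ : tyz_genusPointData)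
    (hGZK : rank_eq_analyticRank_of_analyticRank_le_one)
    (hp : ∀ i, (p i).Prime) (hodd : ∀ i, Odd (p i)) (hinj : Function.Injective p)
    {n : ℕ} (hn : ∏ i, p i = n) (h8 : n % 8 = 5 ∨ n % 8 = 7)
    (L : Fin k → Fin k → ZMod 2) (d2 dm2 : Fin k → ZMod 2)
    (hL : ∀ i j, addLegendreSym (p j) (p i) = L i j) (h2 : ∀ i, addLegendreSym 2 (p i) = d2 i)
    (hm2 : ∀ i, addLegendreSym (-2) (p i) = dm2 i)
    (hker : Fintype.card {v : Fin k ⊕ Fin k → ZMod 2 // Matrix.fromBlocks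
        (Matrix.of (fun i j => if i = j then ∑ l ∈ Finset.univ.erase i, L i l else L i j) +
          Matrix.diagonal d2) (Matrix.diagonal d2) (Matrix.diagonal d2)
        (Matrix.of (fun i j => if i = j then ∑ l ∈ Finset.univ.erase i, L i l else L i j) +
          Matrix.diagonal dm2) *ᵥ v = 0} = 2)
    (hgen : Odd (genusSum₁ n fun d => genusClassNumber (GenusField d)) ∨
      Odd (genusSum₂' n fun d => genusClassNumber (GenusField d))) :
    (congruentNumberCurve n).analyticRank = 1 ∧ (congruentNumberCurve n).mordellWeilRank = 1 ∧
      AddCommGroup.primaryComponent (congruentNumberCurve n).sha 2 = ⊥ ∧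
      BSDp (congruentNumberCurve n) 2 :=
  rankOne_sha_bsdp_two_congruentNumberCurve_of_genusPointData p hTYZ hGZK
    monsky_card_selmerGroup_two_odd_holds hp hodd hinj hn h8 L d2 dm2 hL h2 hm2 hker hgen

/-- **DOOR A ON KERNEL DESCENT — `BSD(E_n, 2)`** (closed form of the previous theorem), modulo `hTYZ`,
`hGZK` only. [cite: TianYuanZhang2017, Thm. 1.2, Thm. 3.5 and §1 (1.1)] [cite: Miller2011LMS, Def. 1.1 (arXiv:1010.2431 p. 3)] -/
theorem bsdp_two_congruentNumberCurve_of_genusPointData_descent (hTYZ : tyz_genusPointData)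
    (hGZK : rank_eq_analyticRank_of_analyticRank_le_one)
    (hp : ∀ i, (p i).Prime) (hodd : ∀ i, Odd (p i)) (hinj : Function.Injective p)
    {n : ℕ} (hn : ∏ i, p i = n) (h8 : n % 8 = 5 ∨ n % 8 = 7)
    (L : Fin k → Fin k → ZMod 2) (d2 dm2 : Fin k → ZMod 2)
    (hL : ∀ i j, addLegendreSym (p j) (p i) = L i j) (h2 : ∀ i, addLegendreSym 2 (p i) = d2 i)
    (hm2 : ∀ i, addLegendreSym (-2) (p i) = dm2 i)
    (hker : Fintype.card {v : Fin k ⊕ Fin k → ZMod 2 // Matrix.fromBlocks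
        (Matrix.of (fun i j => if i = j then ∑ l ∈ Finset.univ.erase i, L i l else L i j) +
          Matrix.diagonal d2) (Matrix.diagonal d2) (Matrix.diagonal d2)
        (Matrix.of (fun i j => if i = j then ∑ l ∈ Finset.univ.erase i, L i l else L i j) +
          Matrix.diagonal dm2) *ᵥ v = 0} = 2)
    (hgen : Odd (genusSum₁ n fun d => genusClassNumber (GenusField d)) ∨
      Odd (genusSum₂' n fun d => genusClassNumber (GenusField d))) :
    BSDp (congruentNumberCurve n) 2 :=
  (rankOne_sha_bsdp_two_congruentNumberCurve_of_genusPointData_descent p hTYZ hGZK hp hodd hinj hn h8 L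
    d2 dm2 hL h2 hm2 hker hgen).2.2.2

/-- **D-CN-6 ON KERNEL DESCENT (Thm 1.2 AS PRINTED, with `ρ(n) = 0`).** For `n = p₁⋯p_k` (distinct odd
primes), `n ≡ 5, 7 (mod 8)`, Monsky kernel count `2`, `ρ(n) = 0` (`hρ`; per member the tree's Faulkner–James
theorems) and `Σ₁(n)` odd or `Σ₂′(n)` odd: `ord_{s=1} L(E_n, s) = 1`, rank `1`, `Ш(E_n)[2^∞] = 0`,
`BSD(E_n, 2)` — modulo `h12` and `hGZK` ONLY (torsion, Tamagawa product and Monsky's matrix theorem are tree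
theorems). [cite: TianYuanZhang2017, Thm. 1.2 and §1 (1.1); proof of Prop. 3.4 (p0016 L146)]
[cite: HeathBrown1994SelmerCongruentII, Appendix (Monsky), typescript p. 39 L10–L33]
[cite: Miller2011LMS, Def. 1.1 (arXiv:1010.2431 p. 3)] -/
theorem rankOne_sha_bsdp_two_congruentNumberCurve_of_genus_descent (h12 : thm12_parity_of_scriptL')
    (hGZK : rank_eq_analyticRank_of_analyticRank_le_one)
    (hp : ∀ i, (p i).Prime) (hodd : ∀ i, Odd (p i)) (hinj : Function.Injective p)
    {n : ℕ} (hn : ∏ i, p i = n) (h8 : n % 8 = 5 ∨ n % 8 = 7)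
    (L : Fin k → Fin k → ZMod 2) (d2 dm2 : Fin k → ZMod 2)
    (hL : ∀ i j, addLegendreSym (p j) (p i) = L i j) (h2 : ∀ i, addLegendreSym 2 (p i) = d2 i)
    (hm2 : ∀ i, addLegendreSym (-2) (p i) = dm2 i)
    (hker : Fintype.card {v : Fin k ⊕ Fin k → ZMod 2 // Matrix.fromBlocks
        (Matrix.of (fun i j => if i = j then ∑ l ∈ Finset.univ.erase i, L i l else L i j) +
          Matrix.diagonal d2) (Matrix.diagonal d2) (Matrix.diagonal d2)
        (Matrix.of (fun i j => if i = j then ∑ l ∈ Finset.univ.erase i, L i l else L i j) +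
          Matrix.diagonal dm2) *ᵥ v = 0} = 2)
    (hρ : (rhoSubgroup n).index = 1)
    (hgen : Odd (genusSum₁ n fun d => genusClassNumber (GenusField d)) ∨
      Odd (genusSum₂' n fun d => genusClassNumber (GenusField d))) :
    haveI := isElliptic_congruentNumberCurve (hn ▸ (squarefree_prod_of_injective p hp hinj).ne_zero)
    (congruentNumberCurve n).analyticRank = 1 ∧ (congruentNumberCurve n).mordellWeilRank = 1 ∧
      AddCommGroup.primaryComponent (congruentNumberCurve n).sha 2 = ⊥ ∧
      BSDp (congruentNumberCurve n) 2 := by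
  haveI : Fact (Nat.Prime 2) := ⟨Nat.prime_two⟩
  obtain ⟨hr1, hrank, hbot, hiff⟩ := bsdp_two_congruentNumberCurve_iff_of_genus' p h12 hGZK
    monsky_card_selmerGroup_two_odd_holds hp hodd hinj hn h8 L d2 dm2 hL h2 hm2 hker hρ hgen
    (torsionOrder_congruentNumberCurve (hn ▸ squarefree_prod_of_injective p hp hinj))
  refine ⟨hr1, hrank, hbot, hiff.mpr ?_⟩
  rw [tamagawaProduct_congruentNumberCurve_prod p hp hodd hinj hn, padicValNat.prime_pow]

/-- **D-CN-6 ON KERNEL DESCENT — `BSD(E_n, 2)`** (closed form), modulo `h12`, `hGZK` only.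
[cite: TianYuanZhang2017, Thm. 1.2 and §1 (1.1)] [cite: Miller2011LMS, Def. 1.1 (arXiv:1010.2431 p. 3)] -/
theorem bsdp_two_congruentNumberCurve_of_genus_descent (h12 : thm12_parity_of_scriptL')
    (hGZK : rank_eq_analyticRank_of_analyticRank_le_one)
    (hp : ∀ i, (p i).Prime) (hodd : ∀ i, Odd (p i)) (hinj : Function.Injective p)
    {n : ℕ} (hn : ∏ i, p i = n) (h8 : n % 8 = 5 ∨ n % 8 = 7)
    (L : Fin k → Fin k → ZMod 2) (d2 dm2 : Fin k → ZMod 2)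
    (hL : ∀ i j, addLegendreSym (p j) (p i) = L i j) (h2 : ∀ i, addLegendreSym 2 (p i) = d2 i)
    (hm2 : ∀ i, addLegendreSym (-2) (p i) = dm2 i)
    (hker : Fintype.card {v : Fin k ⊕ Fin k → ZMod 2 // Matrix.fromBlocks
        (Matrix.of (fun i j => if i = j then ∑ l ∈ Finset.univ.erase i, L i l else L i j) +
          Matrix.diagonal d2) (Matrix.diagonal d2) (Matrix.diagonal d2)
        (Matrix.of (fun i j => if i = j then ∑ l ∈ Finset.univ.erase i, L i l else L i j) +
          Matrix.diagonal dm2) *ᵥ v = 0} = 2)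
    (hρ : (rhoSubgroup n).index = 1)
    (hgen : Odd (genusSum₁ n fun d => genusClassNumber (GenusField d)) ∨
      Odd (genusSum₂' n fun d => genusClassNumber (GenusField d))) :
    BSDp (congruentNumberCurve n) 2 :=
  bsdp_two_congruentNumberCurve_of_genus'' p h12 hGZK monsky_card_selmerGroup_two_odd_holds hp hodd hinj
    hn h8 L d2 dm2 hL h2 hm2 hker hρ hgen

/-- **DOOR B6 ON KERNEL DESCENT (class `6`).** For `n = 2p₁⋯p_k ≡ 6 (mod 8)` (distinct odd primes), even
Monsky kernel count `2` (table route) and `Σ₂′(n)` odd: `ord_{s=1} L(E_n, s) = 1`, rank `1`,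
`Ш(E_n)[2^∞] = 0`, `BSD(E_n, 2)` — modulo `hTYZ`, `hGZK` ONLY (Monsky's even matrix theorem is the tree's
`monsky_card_selmerGroup_two_even_holds`; the printed "sketch" flag no longer rides the door).
[cite: TianYuanZhang2017, Thm. 1.2, Thm. 3.5 and §1 (1.1)]
[cite: HeathBrown1994SelmerCongruentII, Appendix (Monsky), typescript p. 41 L20–L36]
[cite: Miller2011LMS, Def. 1.1 (arXiv:1010.2431 p. 3)] -/
theorem rankOne_sha_bsdp_two_congruentNumberCurve_of_genusPointData_six_descent (hTYZ : tyz_genusPointData)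
    (hGZK : rank_eq_analyticRank_of_analyticRank_le_one)
    (hp : ∀ i, (p i).Prime) (hodd : ∀ i, Odd (p i)) (hinj : Function.Injective p)
    {n : ℕ} (hn : 2 * ∏ i, p i = n) (h8 : n % 8 = 6)
    (L : Fin k → Fin k → ZMod 2) (d2 dm1 : Fin k → ZMod 2)
    (hL : ∀ i j, addLegendreSym (p j) (p i) = L i j) (h2 : ∀ i, addLegendreSym 2 (p i) = d2 i)
    (hm1 : ∀ i, addLegendreSym (-1) (p i) = dm1 i)
    (hker : Fintype.card {v : Fin k ⊕ Fin k → ZMod 2 // Matrix.fromBlocks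
        ((Matrix.of (fun i j => if i = j then ∑ l ∈ Finset.univ.erase i, L i l else L i j))ᵀ +
          Matrix.diagonal d2) (Matrix.diagonal dm1) (Matrix.diagonal d2)
        (Matrix.of (fun i j => if i = j then ∑ l ∈ Finset.univ.erase i, L i l else L i j) +
          Matrix.diagonal d2) *ᵥ v = 0} = 2)
    (hgen : Odd (genusSum₂' n fun d => genusClassNumber (GenusField d))) :
    (congruentNumberCurve n).analyticRank = 1 ∧ (congruentNumberCurve n).mordellWeilRank = 1 ∧
      AddCommGroup.primaryComponent (congruentNumberCurve n).sha 2 = ⊥ ∧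
      BSDp (congruentNumberCurve n) 2 :=
  rankOne_sha_bsdp_two_congruentNumberCurve_of_genusPointData_six p hTYZ hGZK
    monsky_card_selmerGroup_two_even_holds hp hodd hinj hn h8 L d2 dm1 hL h2 hm1 hker hgen

/-- **DOOR B6 ON KERNEL DESCENT — `BSD(E_n, 2)`** (closed form), modulo `hTYZ`, `hGZK` only.
[cite: TianYuanZhang2017, Thm. 1.2, Thm. 3.5 and §1 (1.1)] [cite: Miller2011LMS, Def. 1.1 (arXiv:1010.2431 p. 3)] -/
theorem bsdp_two_congruentNumberCurve_of_genusPointData_six_descent (hTYZ : tyz_genusPointData)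
    (hGZK : rank_eq_analyticRank_of_analyticRank_le_one)
    (hp : ∀ i, (p i).Prime) (hodd : ∀ i, Odd (p i)) (hinj : Function.Injective p)
    {n : ℕ} (hn : 2 * ∏ i, p i = n) (h8 : n % 8 = 6)
    (L : Fin k → Fin k → ZMod 2) (d2 dm1 : Fin k → ZMod 2)
    (hL : ∀ i j, addLegendreSym (p j) (p i) = L i j) (h2 : ∀ i, addLegendreSym 2 (p i) = d2 i)
    (hm1 : ∀ i, addLegendreSym (-1) (p i) = dm1 i)
    (hker : Fintype.card {v : Fin k ⊕ Fin k → ZMod 2 // Matrix.fromBlocks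
        ((Matrix.of (fun i j => if i = j then ∑ l ∈ Finset.univ.erase i, L i l else L i j))ᵀ +
          Matrix.diagonal d2) (Matrix.diagonal dm1) (Matrix.diagonal d2)
        (Matrix.of (fun i j => if i = j then ∑ l ∈ Finset.univ.erase i, L i l else L i j) +
          Matrix.diagonal d2) *ᵥ v = 0} = 2)
    (hgen : Odd (genusSum₂' n fun d => genusClassNumber (GenusField d))) :
    BSDp (congruentNumberCurve n) 2 :=
  (rankOne_sha_bsdp_two_congruentNumberCurve_of_genusPointData_six_descent p hTYZ hGZK hp hodd hinj hn h8
    L d2 dm1 hL h2 hm1 hker hgen).2.2.2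

end General

/-! ## §2 The `ω(n) = 3` atlas in configuration currency, on kernel descent -/

section Atlas

variable (p : Fin 3 → ℕ)

/-- **DOOR A IN CONFIGURATION CURRENCY, ON KERNEL DESCENT (`ω(n) = 3`).** For distinct primes
`p₀, p₁, p₂` whose Legendre configuration satisfies `doorACfg`: `ord_{s=1} L(E_n, s) = 1`, rank `1`,
`Ш(E_n)[2^∞] = 0`, `BSD(E_n, 2)` (`n = p₀p₁p₂`) — modulo `hTYZ`, `hGZK` ONLY (Monsky's matrix theorem and
Rédei–Reichardt are tree theorems). [cite: TianYuanZhang2017, Thm. 1.2, Thm. 3.5 and §1 (1.1)]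
[cite: HeathBrown1994SelmerCongruentII, Appendix (Monsky), typescript p. 39 L10–L33]
[cite: Miller2011LMS, Def. 1.1 (arXiv:1010.2431 p. 3)] -/
theorem rankOne_sha_bsdp_two_congruentNumberCurve_of_doorACfg_descent (hTYZ : tyz_genusPointData)
    (hGZK : rank_eq_analyticRank_of_analyticRank_le_one)
    (hp : ∀ i, (p i).Prime) (hinj : Function.Injective p) {n : ℕ} (hn : ∏ i, p i = n)
    (hcfg : doorACfg (fun i => p i % 8) (fun a b => kroneckerBit (p b) (p a)) = true) :
    (congruentNumberCurve n).analyticRank = 1 ∧ (congruentNumberCurve n).mordellWeilRank = 1 ∧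
      AddCommGroup.primaryComponent (congruentNumberCurve n).sha 2 = ⊥ ∧
      BSDp (congruentNumberCurve n) 2 :=
  rankOne_sha_bsdp_two_congruentNumberCurve_of_doorACfg p hTYZ hGZK monsky_card_selmerGroup_two_odd_holds
    redeiReichardt_fourTwoCard_classGroup_holds hp hinj hn hcfg

/-- **EVERY `ω = 3` DOOR-A FAMILY AS A ONE-LINER, ON KERNEL DESCENT (upper-bits form).** Fix residues
`r₀, r₁, r₂ (mod 8)` and symbol bits `s₀, s₁, s₂` with `doorACfg r (betaOf r s) = true` (`by decide`); then
for ALL distinct primes realising the configuration, `ord_{s=1} L(E_{p₀p₁p₂}, s) = 1` and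
`BSD(E_{p₀p₁p₂}, 2)`, modulo `hTYZ`, `hGZK` only. [cite: TianYuanZhang2017, Thm. 1.2, Thm. 3.5 and §1 (1.1)]
[cite: IrelandRosen1990, Ch. 5 §2 Thm. 1] [cite: Miller2011LMS, Def. 1.1 (arXiv:1010.2431 p. 3)] -/
theorem bsdp_two_congruentNumberCurve_three_primes_of_doorACfg_descent (hTYZ : tyz_genusPointData)
    (hGZK : rank_eq_analyticRank_of_analyticRank_le_one) (r₀ r₁ r₂ : Fin 8) (s₀ s₁ s₂ : ZMod 2)
    (hcfg : doorACfg ![r₀.val, r₁.val, r₂.val]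
      (betaOf ![r₀.val, r₁.val, r₂.val] ![s₀, s₁, s₂]) = true)
    {p₀ p₁ p₂ : ℕ} (hp₀ : p₀.Prime) (hp₁ : p₁.Prime) (hp₂ : p₂.Prime)
    (h01 : p₀ ≠ p₁) (h02 : p₀ ≠ p₂) (h12 : p₁ ≠ p₂)
    (hr₀ : p₀ % 8 = r₀.val) (hr₁ : p₁ % 8 = r₁.val) (hr₂ : p₂ % 8 = r₂.val)
    (hs₀ : kroneckerBit p₁ p₀ = s₀) (hs₁ : kroneckerBit p₂ p₀ = s₁) (hs₂ : kroneckerBit p₂ p₁ = s₂) :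
    haveI := isElliptic_congruentNumberCurve
      (Nat.mul_ne_zero (Nat.mul_ne_zero hp₀.ne_zero hp₁.ne_zero) hp₂.ne_zero)
    (congruentNumberCurve (p₀ * p₁ * p₂)).analyticRank = 1 ∧
      BSDp (congruentNumberCurve (p₀ * p₁ * p₂)) 2 :=
  bsdp_two_congruentNumberCurve_three_primes_of_doorACfg hTYZ hGZK monsky_card_selmerGroup_two_odd_holds
    redeiReichardt_fourTwoCard_classGroup_holds r₀ r₁ r₂ s₀ s₁ s₂ hcfg hp₀ hp₁ hp₂ h01 h02 h12 hr₀ hr₁ hr₂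
    hs₀ hs₁ hs₂

/-- **CLASS `7`, `ω(n) = 3`, ON KERNEL DESCENT: `s(n) = 1` ALONE GIVES `BSD(E_n, 2)`.** For distinct primes
with `p₀p₁p₂ ≡ 7 (mod 8)` and a `2`-element kernel of Monsky's matrix: `r_an = 1`, rank `1`, `Ш[2^∞] = 0`,
`BSD(E_n, 2)`, modulo `hTYZ`, `hGZK` only. [cite: TianYuanZhang2017, Thm. 1.2, Thm. 3.5 and §1 (1.1)]
[cite: HeathBrown1994SelmerCongruentII, Appendix (Monsky), typescript p. 39 L10–L33]
[cite: Miller2011LMS, Def. 1.1 (arXiv:1010.2431 p. 3)] -/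
theorem rankOne_sha_bsdp_two_congruentNumberCurve_three_primes_seven_descent (hTYZ : tyz_genusPointData)
    (hGZK : rank_eq_analyticRank_of_analyticRank_le_one)
    (hp : ∀ i, (p i).Prime) (hinj : Function.Injective p) {n : ℕ} (hn : ∏ i, p i = n)
    (h7 : n % 8 = 7)
    (hker : Fintype.card {v : Fin 3 ⊕ Fin 3 → ZMod 2 // monskyMatrixOdd p *ᵥ v = 0} = 2) :
    (congruentNumberCurve n).analyticRank = 1 ∧ (congruentNumberCurve n).mordellWeilRank = 1 ∧
      AddCommGroup.primaryComponent (congruentNumberCurve n).sha 2 = ⊥ ∧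
      BSDp (congruentNumberCurve n) 2 :=
  rankOne_sha_bsdp_two_congruentNumberCurve_three_primes_seven p hTYZ hGZK
    monsky_card_selmerGroup_two_odd_holds redeiReichardt_fourTwoCard_classGroup_holds hp hinj hn h7 hker

/-- **`BSD(E_n, 2)` for EVERY `n = p₀p₁p₂ ≡ 7 (mod 8)` with `s(n) = 1`, ON KERNEL DESCENT** (`∀`-form),
modulo `hTYZ`, `hGZK` only. [cite: TianYuanZhang2017, Thm. 1.2, Thm. 3.5 and §1 (1.1)]
[cite: HeathBrown1994SelmerCongruentII, Appendix (Monsky), typescript p. 39 L33]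
[cite: Miller2011LMS, Def. 1.1 (arXiv:1010.2431 p. 3)] -/
theorem forall_bsdp_two_congruentNumberCurve_three_primes_seven_descent (hTYZ : tyz_genusPointData)
    (hGZK : rank_eq_analyticRank_of_analyticRank_le_one) :
    ∀ p : Fin 3 → ℕ, (∀ i, (p i).Prime) → Function.Injective p → (∏ i, p i) % 8 = 7 →
      monskySelmerRankOdd p = 1 → BSDp (congruentNumberCurve (∏ i, p i)) 2 :=
  forall_bsdp_two_congruentNumberCurve_three_primes_seven hTYZ hGZK monsky_card_selmerGroup_two_odd_holds
    redeiReichardt_fourTwoCard_classGroup_holds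

/-- **CLASS `5`, `ω(n) = 3`, ON KERNEL DESCENT: `s(n) = 1` OFF THE EXCEPTIONAL CONFIGURATION.** For
distinct primes with `p₀p₁p₂ ≡ 5 (mod 8)`, Monsky kernel `2`, configuration not `p₅·q₇·r₇` with
`(q/p) = (r/p) = −1`: `r_an = 1`, rank `1`, `Ш[2^∞] = 0`, `BSD(E_n, 2)`, modulo `hTYZ`, `hGZK` only.
[cite: TianYuanZhang2017, Thm. 1.2, Thm. 3.5 and §1 (1.1)]
[cite: HeathBrown1994SelmerCongruentII, Appendix (Monsky), typescript p. 39 L10–L33]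
[cite: Miller2011LMS, Def. 1.1 (arXiv:1010.2431 p. 3)] -/
theorem rankOne_sha_bsdp_two_congruentNumberCurve_three_primes_five_descent (hTYZ : tyz_genusPointData)
    (hGZK : rank_eq_analyticRank_of_analyticRank_le_one)
    (hp : ∀ i, (p i).Prime) (hinj : Function.Injective p) {n : ℕ} (hn : ∏ i, p i = n)
    (h5 : n % 8 = 5)
    (hker : Fintype.card {v : Fin 3 ⊕ Fin 3 → ZMod 2 // monskyMatrixOdd p *ᵥ v = 0} = 2)
    (hexc : exceptionalFiveCfg (fun i => p i % 8) (fun a b => kroneckerBit (p b) (p a)) = false) :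
    (congruentNumberCurve n).analyticRank = 1 ∧ (congruentNumberCurve n).mordellWeilRank = 1 ∧
      AddCommGroup.primaryComponent (congruentNumberCurve n).sha 2 = ⊥ ∧
      BSDp (congruentNumberCurve n) 2 :=
  rankOne_sha_bsdp_two_congruentNumberCurve_three_primes_five p hTYZ hGZK
    monsky_card_selmerGroup_two_odd_holds redeiReichardt_fourTwoCard_classGroup_holds hp hinj hn h5 hker hexc

/-- **The sample family `p₁·q₃·r₅` with `(q/p) = −1`, ON KERNEL DESCENT**: `BSD(E_{pqr}, 2)` for ALL primes
`p ≡ 1`, `q ≡ 3`, `r ≡ 5 (mod 8)` with `(q/p) = −1`, modulo `hTYZ`, `hGZK` only.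
[cite: TianYuanZhang2017, Thm. 1.2, Thm. 3.5 and §1 (1.1)] [cite: IrelandRosen1990, Ch. 5 §1 Prop. 5.1.2]
[cite: Miller2011LMS, Def. 1.1 (arXiv:1010.2431 p. 3)] -/
theorem forall_bsdp_two_congruentNumberCurve_one_three_five_descent (hTYZ : tyz_genusPointData)
    (hGZK : rank_eq_analyticRank_of_analyticRank_le_one) :
    ∀ p q r : ℕ, p.Prime → q.Prime → r.Prime → p % 8 = 1 → q % 8 = 3 → r % 8 = 5 →
      jacobiSym q p = -1 → BSDp (congruentNumberCurve (p * q * r)) 2 :=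
  forall_bsdp_two_congruentNumberCurve_one_three_five hTYZ hGZK monsky_card_selmerGroup_two_odd_holds
    redeiReichardt_fourTwoCard_classGroup_holds

end Atlas

end Summit.BirchSwinnertonDyer.Rank1Residual.P2

end
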